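import Mathlib
import HarnessLib
import Summits.Ventures.LatticeQCDFlow.Scaling.TorusRankedMorseCount

/-!
# LatticeQCDFlow / Scaling — along EVERY generation order of the links of `(ℤ/L)^d` at most
# `(d−1)(L^d − 1)` links close a plaquette, so at least `k_min(d, L)` plaquettes are closed by a link
# that closes another plaquette at the same time — the order-free form of the `k_min` law

HONEST FRAMING: exact (Metropolis-corrected) sampling algorithms for lattice gauge theory;
figures of merit are autocorrelation/cost numbers at stated couplings and volumes; no
continuum-physics claim.

Venture `LatticeQCDFlow` (cell pub-lqcd), topic `Scaling`, FANOUT row 30 (lean-1, GEN-27) — OUR WORK on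
THEORY-2.md §4 row C5.  An autoregressive link sampler draws the links of `(ℤ/L)^d` one by one along some
order `l`; a plaquette is CLOSED by its last link in `l`.  GEN-24/25 (`TorusRankedHomologyBound`,
`TorusRankedMorseCount`) proved that a RANKED structure — the plaquettes an exact one-plaquette heat-bath
autoregression can cover — has at most `(d−1)(L^d − 1)` plaquettes, leaving `k_min(d, L) =
(d−1)(d−2)/2·L^d + (d−1)` outside; `TorusPlaquetteLastLinks` (GEN-21) counted closing links crudely
(`≥ #plaquettes/(2(d−1))`).  Here the sharp, ORDER-FREE statement, for every order and every sampler: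

* §1 **`card_image_lastLink_le`** — along every list `l` of all links and for every last-link selector
  `last` (`last p` a link of `p` of maximal position in `l`), AT MOST `(d−1)(L^d − 1)` LINKS CLOSE A
  PLAQUETTE: one closed plaquette per closing link is a ranked structure (top link = the closing link, rank
  = its position), and the homology bound applies;
* §2 **`kmin_add_card_image_lastLink_le`** — hence `k_min(d, L) + #{closing links} ≤ #plaquettes`: AT LEAST
  `k_min(d, L)` PLAQUETTES ARE CLOSED BY A LINK THAT SIMULTANEOUSLY CLOSES ANOTHER PLAQUETTE
  (**`kmin_le_sum_excess`**: `Σ_{closing e} (#{p : last p = e} − 1) ≥ k_min`) — whatever the conditioners,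
  at these plaquettes one link draw must serve two or more plaquette weights; for one-plaquette heat-bath
  conditioners this is the `k_min` law of GEN-25 again, now for an arbitrary order rather than a compatible one;
* §3 **`exists_order_card_image_lastLink_eq`** — TIGHT: along a compatible order of the Morse structure
  (`TorusRankedMorseCount.exists_ranked_card_compl_eq`, `PlaquetteTopLinkOrders.exists_order_of_topLink_rank`)
  exactly `(d−1)(L^d − 1)` links close a plaquette.

No `def` (the selector `last` is a hypothesis), no `sorry`, nothing cited as a fact beyond the tree.
-/

namespace Summit.Ventures.LatticeQCDFlow.Theory2.Autoregressive

open Finset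
open Literature.MathematicalPhysics.QuantumFieldTheory

variable {d L : ℕ} [NeZero L]

/-! ## §1 At most `(d−1)(L^d − 1)` closing links -/

/-- **ALONG EVERY ORDER AT MOST `(d−1)(L^d − 1)` LINKS CLOSE A PLAQUETTE.**  `L ≥ 2`; `l` a list containing
every link; `last p` a link of `p` whose position in `l` is maximal among the four links of `p`.  Then the set
of closing links `{last p}` has at most `(d−1)(L^d − 1)` elements: choosing one closed plaquette per closing
link gives a ranked structure (top link `last`, rank the position of `last p` in `l` — any other plaquette of
the structure through `last p` is closed strictly later), to which `TorusRankedHomologyBound` applies. [ours] -/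
theorem card_image_lastLink_le (hL : 2 ≤ L) (l : List (Edge d L)) (hall : ∀ e : Edge d L, e ∈ l)
    (last : Plaquette d L → Edge d L)
    (hmem : ∀ p : Plaquette d L, last p ∈ ({(p.1, p.2.1.1), (p.1.shift p.2.1.1, p.2.1.2),
        (p.1.shift p.2.1.2, p.2.1.1), (p.1, p.2.1.2)} : Finset (Edge d L)))
    (hmax : ∀ p : Plaquette d L, ∀ e' ∈ ({(p.1, p.2.1.1), (p.1.shift p.2.1.1, p.2.1.2),
        (p.1.shift p.2.1.2, p.2.1.1), (p.1, p.2.1.2)} : Finset (Edge d L)), l.idxOf e' ≤ l.idxOf (last p)) :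
    (Finset.univ.image last).card ≤ (d - 1) * (L ^ d - 1) := by
  classical
  rcases isEmpty_or_nonempty (Plaquette d L) with hE | ⟨⟨p₀⟩⟩
  · simp
  -- one closed plaquette per closing link
  have hsec : ∀ e : Edge d L, ∃ p : Plaquette d L, e ∈ Finset.univ.image last → last p = e := by
    intro e
    by_cases he : e ∈ Finset.univ.image last
    · obtain ⟨p, -, hp⟩ := Finset.mem_image.1 he
      exact ⟨p, fun _ => hp⟩
    · exact ⟨p₀, fun h => absurd h he⟩
  choose P hP using hsec
  set T : Finset (Edge d L) := Finset.univ.image last with hT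
  set B : Finset (Plaquette d L) := T.image P with hB
  have hlastP : ∀ e ∈ T, last (P e) = e := fun e he => hP e he
  have hPinj : Set.InjOn P T := by
    intro e he e' he' h
    rw [← hlastP e he, ← hlastP e' he', h]
  have hcardB : B.card = T.card := Finset.card_image_of_injOn hPinj
  have hmemB : ∀ p ∈ B, P (last p) = p := by
    intro p hp
    obtain ⟨e, he, rfl⟩ := Finset.mem_image.1 hp
    rw [hlastP e he]
  -- the structure `(B, last, idxOf ∘ last)` is ranked
  have hrank : ∀ p ∈ B, ∀ p' ∈ B, p ≠ p' → last p ∈ ({(p'.1, p'.2.1.1), (p'.1.shift p'.2.1.1, p'.2.1.2),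
        (p'.1.shift p'.2.1.2, p'.2.1.1), (p'.1, p'.2.1.2)} : Finset (Edge d L)) →
      l.idxOf (last p) < l.idxOf (last p') := by
    intro p hp p' hp' hne hlp
    refine lt_of_le_of_ne (hmax p' (last p) hlp) fun heq => hne ?_
    have hll : last p = last p' := (List.idxOf_inj (hall (last p))).1 heq
    rw [← hmemB p hp, ← hmemB p' hp', hll]
  have hbound := card_add_card_site_add_le_card_edge_add_one_of_ranked hL B last (fun p _ => hmem p)
    (fun p => l.idxOf (last p)) hrank
  rw [Summit.Ventures.LatticeQCDFlow.Runbook.card_site, Summit.Ventures.LatticeQCDFlow.Runbook.card_edge,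
    hcardB] at hbound
  -- `#T + L^d + d ≤ d·L^d + 1` means `#T ≤ (d−1)(L^d − 1)`
  have hX : 1 ≤ L ^ d := Nat.one_le_pow _ _ (by omega)
  rcases Nat.eq_zero_or_pos d with hd | hd
  · subst hd
    simp only [pow_zero, mul_zero, add_zero] at hbound
    simp only [Nat.zero_sub, zero_mul, nonpos_iff_eq_zero, Finset.card_eq_zero]
    have h0 : T.card = 0 := by omega
    exact Finset.card_eq_zero.1 h0
  · obtain ⟨Y, hY⟩ : ∃ Y, L ^ d = Y + 1 := ⟨L ^ d - 1, by omega⟩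
    rw [hY] at hbound ⊢
    obtain ⟨e, rfl⟩ : ∃ e, d = e + 1 := ⟨d - 1, by omega⟩
    simp only [Nat.add_sub_cancel]
    have h5 : (Y + 1) * (e + 1) = e * Y + Y + e + 1 := by ring
    rw [h5] at hbound
    nlinarith [hbound]

/-! ## §2 At least `k_min(d, L)` plaquettes share their closing link -/

/-- **`k_min(d, L) + #{closing links} ≤ #plaquettes`** along every order (`L ≥ 2`): at least
`k_min(d, L) = (d−1)(d−2)/2·L^d + (d−1)` plaquettes are NOT the only plaquette closed by their last link.
[ours] -/
theorem kmin_add_card_image_lastLink_le (hL : 2 ≤ L) (l : List (Edge d L)) (hall : ∀ e : Edge d L, e ∈ l)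
    (last : Plaquette d L → Edge d L)
    (hmem : ∀ p : Plaquette d L, last p ∈ ({(p.1, p.2.1.1), (p.1.shift p.2.1.1, p.2.1.2),
        (p.1.shift p.2.1.2, p.2.1.1), (p.1, p.2.1.2)} : Finset (Edge d L)))
    (hmax : ∀ p : Plaquette d L, ∀ e' ∈ ({(p.1, p.2.1.1), (p.1.shift p.2.1.1, p.2.1.2),
        (p.1.shift p.2.1.2, p.2.1.1), (p.1, p.2.1.2)} : Finset (Edge d L)), l.idxOf e' ≤ l.idxOf (last p)) :
    (d - 1) * (d - 2) / 2 * L ^ d + (d - 1) + (Finset.univ.image last).card ≤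
      Fintype.card (Plaquette d L) := by
  have h1 := card_image_lastLink_le hL l hall last hmem hmax
  have hP := two_mul_card_plaquette d L
  rw [Summit.Ventures.LatticeQCDFlow.Runbook.card_site] at hP
  have hE := two_mul_choose_coeff d
  have hX : 1 ≤ L ^ d := Nat.one_le_pow _ _ (by omega)
  rcases Nat.lt_or_ge d 2 with hd | hd
  · interval_cases d
    · simp only [Nat.zero_sub, zero_mul, Nat.zero_div, zero_add] at h1 ⊢
      omega
    · simp only [Nat.sub_self, zero_mul, Nat.zero_div, mul_zero, zero_add, add_zero] at h1 hP ⊢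
      omega
  · obtain ⟨e, rfl⟩ : ∃ e, d = e + 2 := ⟨d - 2, by omega⟩
    obtain ⟨Y, hY⟩ : ∃ Y, L ^ (e + 2) = Y + 1 := ⟨L ^ (e + 2) - 1, by omega⟩
    simp only [Nat.add_sub_cancel, show e + 2 - 1 = e + 1 from rfl] at h1 hP hE ⊢
    rw [hY] at h1 hP ⊢
    simp only [Nat.add_sub_cancel] at h1
    have h2 : (e + 1) * e / 2 * 2 = (e + 1) * e := by
      have := Nat.div_mul_cancel (Nat.even_mul_pred_self (e + 1)).two_dvd
      simpa [Nat.add_sub_cancel, mul_comm] using this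
    nlinarith [h1, hP, h2]

/-- **EXCESS CLOSINGS.**  Along every order, summing over the closing links the number of plaquettes each
closes beyond the first gives at least `k_min(d, L)`: `Σ_e (#{p : last p = e} − 1) ≥ k_min(d, L)` — for ANY
autoregressive link sampler of `(ℤ/L)^d`, at `≥ k_min(d, L)` plaquettes one link draw must serve two or more
plaquette weights at once. [ours] -/
theorem kmin_le_sum_excess (hL : 2 ≤ L) (l : List (Edge d L)) (hall : ∀ e : Edge d L, e ∈ l)
    (last : Plaquette d L → Edge d L)
    (hmem : ∀ p : Plaquette d L, last p ∈ ({(p.1, p.2.1.1), (p.1.shift p.2.1.1, p.2.1.2),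
        (p.1.shift p.2.1.2, p.2.1.1), (p.1, p.2.1.2)} : Finset (Edge d L)))
    (hmax : ∀ p : Plaquette d L, ∀ e' ∈ ({(p.1, p.2.1.1), (p.1.shift p.2.1.1, p.2.1.2),
        (p.1.shift p.2.1.2, p.2.1.1), (p.1, p.2.1.2)} : Finset (Edge d L)), l.idxOf e' ≤ l.idxOf (last p)) :
    (d - 1) * (d - 2) / 2 * L ^ d + (d - 1) ≤
      ∑ e ∈ Finset.univ.image last, ((Finset.univ.filter fun p : Plaquette d L => last p = e).card - 1) := by
  classical
  have h1 := kmin_add_card_image_lastLink_le hL l hall last hmem hmax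
  have hfib : Fintype.card (Plaquette d L) =
      ∑ e ∈ Finset.univ.image last, (Finset.univ.filter fun p : Plaquette d L => last p = e).card := by
    rw [← Finset.card_univ]
    exact Finset.card_eq_sum_card_image last Finset.univ
  have hpos : ∀ e ∈ Finset.univ.image last,
      1 ≤ (Finset.univ.filter fun p : Plaquette d L => last p = e).card := by
    intro e he
    obtain ⟨p, -, hp⟩ := Finset.mem_image.1 he
    exact Finset.card_pos.2 ⟨p, Finset.mem_filter.2 ⟨Finset.mem_univ _, hp⟩⟩
  have hsum : ∑ e ∈ Finset.univ.image last, ((Finset.univ.filter fun p : Plaquette d L => last p = e).card - 1) +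
      (Finset.univ.image last).card =
      ∑ e ∈ Finset.univ.image last, (Finset.univ.filter fun p : Plaquette d L => last p = e).card := by
    rw [Finset.card_eq_sum_ones, ← Finset.sum_add_distrib]
    exact Finset.sum_congr rfl fun e he => Nat.sub_add_cancel (hpos e he)
  omega

/-! ## §3 Tightness: a compatible order of the Morse structure -/

/-- **TIGHT: along some order exactly `(d−1)(L^d − 1)` links close a plaquette** (`L ≥ 2`): a compatible order
of the full ranked Morse structure of `TorusRankedMorseStructure` (every top link comes after the other three
links of its plaquette), along which every top link is a closing link — for every last-link selector. [ours] -/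
theorem exists_order_card_image_lastLink_eq (hL : 2 ≤ L) :
    ∃ l : List (Edge d L), l.Nodup ∧ (∀ e : Edge d L, e ∈ l) ∧
      ∀ last : Plaquette d L → Edge d L,
        (∀ p : Plaquette d L, last p ∈ ({(p.1, p.2.1.1), (p.1.shift p.2.1.1, p.2.1.2),
        (p.1.shift p.2.1.2, p.2.1.1), (p.1, p.2.1.2)} : Finset (Edge d L))) →
        (∀ p : Plaquette d L, ∀ e' ∈ ({(p.1, p.2.1.1), (p.1.shift p.2.1.1, p.2.1.2),
        (p.1.shift p.2.1.2, p.2.1.1), (p.1, p.2.1.2)} : Finset (Edge d L)), l.idxOf e' ≤ l.idxOf (last p)) →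
        (Finset.univ.image last).card = (d - 1) * (L ^ d - 1) := by
  classical
  obtain ⟨B, t, rank, hinj, ht, hrank, -, hcard⟩ := exists_ranked_card_compl_eq (d := d) hL
  obtain ⟨l, hnodup, hall, hcompat⟩ := exists_order_of_topLink_rank B t hinj rank hrank
  refine ⟨l, hnodup, hall, fun last hmem hmax => le_antisymm (card_image_lastLink_le hL l hall last hmem hmax) ?_⟩
  -- every top link is the last link of its plaquette
  have hlast : ∀ p ∈ B, last p = t p := by
    intro p hp
    by_contra hne
    have h1 := hcompat p hp (last p) (hmem p) hne
    have h2 := hmax p (t p) (ht p hp)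
    omega
  have hsub : B.image t ⊆ Finset.univ.image last := by
    intro e he
    obtain ⟨p, hp, rfl⟩ := Finset.mem_image.1 he
    exact Finset.mem_image.2 ⟨p, Finset.mem_univ _, hlast p hp⟩
  have h := Finset.card_le_card hsub
  rwa [Finset.card_image_of_injOn hinj, hcard] at h

end Summit.Ventures.LatticeQCDFlow.Theory2.Autoregressive
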